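import Literature.NumberTheory.Sieve.BombieriFriedlanderIwaniecDispersion
import Mathlib.NumberTheory.DirichletCharacter.Orthogonality
import HarnessLib

/-!
# Drappeau 2017: convolutions in arithmetic progressions with the conductor-truncated kernel `𝔲_R`

S. Drappeau, *Sums of Kloosterman sums in arithmetic progressions, and the error term in the
dispersion method*, Proc. London Math. Soc. (3) 114 (2017) 684–732 = arXiv:1504.05549, §5
(`Drappeau2017`; held as `paper:arxiv-1504.05549`, statement of Theorem 5.1 read on chunk 17).

## Contents

* `Drappeau2017.uR R d t` — the kernel `𝔲_R(t; d) := φ(d)⁻¹ ∑_{χ mod d, cond χ > R} χ(t)`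
  (§5, (5.1), second form), which "vanishes when `d ≤ R` or `(t, d) > 1`".
* `Drappeau2017.mainKernel R d t` — the complementary small-conductor kernel
  `φ(d)⁻¹ ∑_{χ mod d, cond χ ≤ R} χ(t)`, so that `mainKernel + uR = φ(d)⁻¹ ∑_χ χ(t) (= 1_{t = 1})`
  (`Drappeau2017.mainKernel_add_uR`, proved).
* NAMED FACT `Drappeau2017_theorem51` — **Theorem 5.1** (hypothesis-free Type-II estimate for
  `∑_{q ∼ Q, (q,a₁a₂)=1} ∑_{m ∼ M} ∑_{n ∼ N, (n,a₂)=1} α_m β_n 𝔲_R(m n ā₁ a₂; q)` with a POWER saving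
  `R⁻¹`, valid for `Q` up to `x^{1/2+δ}`: "there are no equidistribution assumptions on our
  sequences").  Deep theorem (Linnik's dispersion method + the author's Theorem 2.1, bounds for sums
  of Kloosterman sums in arithmetic progressions via the Kuznetsov formula); vendored as a named fact
  (D-0014), users take `(h : Drappeau2017_theorem51)`.

## Faithfulness (arXiv:1504.05549, §5, Theorem 5.1)

"Let `M, N, Q, R ≥ 1` and `η` be given, with `x := MN` and `x^{1/4} ≤ Q`. Then there exists `δ`
depending at most on `η` such that the following holds. Let two sequences `(α_m)`, `(β_n)` supported
in `n ∈ (N, 2N]` and `m ∈ (M, 2M]` be given, which satisfy for some `A ≥ 1`, `|α_m| ≤ τ(m)^A`,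
`|β_n| ≤ τ(n)^A`. Let `a₁, a₂ ∈ ℤ ∖ {0}`, and assume that `x^η ≤ N ≤ Q^{2/3−η}`, `Q ≤ x^{1/2+δ}`,
`R, |a₁|, |a₂| ≤ x^δ`. Then for small enough `η`, we have
`∑_{Q<q≤2Q, (q,a₁a₂)=1} ∑_{n,m, (n,a₂)=1} α_m β_n 𝔲_R(mn ā₁ a₂; q) ≪ x (log x)^{O(1)} R⁻¹`.
The implicit constants depend on `η` and `A` at most."
Rendering: `∀ η > 0, ∃ δ > 0, ∀ A ≥ 0, ∃ C c₀ x₀, ∀ x ≥ x₀ …` — `δ = δ(η)`; the implicit constant and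
the exponent `O(1)` of `log x` are `C`, `c₀`, chosen after `A`; "for small enough `η`" is the monotone
reading `∀ η > 0` (the hypotheses `x^η ≤ N ≤ Q^{2/3−η}` only shrink as `η` grows); `∃ x₀` weakens the
printed uniformity in `x`; divisor bounds with a real exponent `A ≥ 0` (for `A < 1` implied by the
case `A = 1`); the signed `≪` is rendered as a bound for the norm of the (complex) left-hand side;
`q ∼ Q` etc. are `BFI.dyadic` (`M < m ≤ 2M`); `ā₁` is the inverse in `ZMod q`, legitimate since
`(q, a₁) = 1` on the range of summation.  `M ≥ 1` is implied for large `x` by `N ≤ Q^{2/3−η} < x`.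

Consumers: crux `TypeI2Dilated` of route `Summits/Parity/GeneralizedHardyLittlewood/Theses/
LiouvilleShiftedTables.lean` (line `peel-to-drappeau`, stub `stub_drappeau`).
-/

open Finset Real
open scoped ArithmeticFunction.sigma

noncomputable section

namespace Literature.NumberTheory.Sieve

namespace Drappeau2017

/-- Drappeau's conductor-truncated kernel (arXiv:1504.05549 §5, (5.1), second form)
`𝔲_R(t; d) := φ(d)⁻¹ ∑_{χ mod d, cond χ > R} χ(t)`; it vanishes for `d ≤ R` and for non-units `t`.
[cite: Drappeau2017, §5 (5.1)] -/
def uR (R : ℝ) (d : ℕ) (t : ZMod d) : ℂ :=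
  ((Nat.totient d : ℂ))⁻¹ *
    ∑ χ : DirichletCharacter ℂ d, if R < (χ.conductor : ℝ) then χ t else 0

/-- The complementary small-conductor ("major arc") kernel
`K_R(t; d) := φ(d)⁻¹ ∑_{χ mod d, cond χ ≤ R} χ(t)` (the subtracted term in the first form of (5.1):
`𝔲_R(t; d) = 1_{t ≡ 1 (d)} − φ(d)⁻¹ ∑_{χ ∈ 𝒳_d(R)} χ(t)`, `𝒳_d(R) = {χ mod d : cond χ ≤ R}`).
[cite: Drappeau2017, §5 (5.1)] -/
def mainKernel (R : ℝ) (d : ℕ) (t : ZMod d) : ℂ :=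
  ((Nat.totient d : ℂ))⁻¹ *
    ∑ χ : DirichletCharacter ℂ d, if (χ.conductor : ℝ) ≤ R then χ t else 0

/-- The two kernels recompose the full character sum:
`K_R(t; d) + 𝔲_R(t; d) = φ(d)⁻¹ ∑_{χ mod d} χ(t)` (equality of the two forms of (5.1)).
[cite: Drappeau2017, §5 (5.1)] -/
theorem mainKernel_add_uR (R : ℝ) (d : ℕ) (t : ZMod d) :
    mainKernel R d t + uR R d t = ((Nat.totient d : ℂ))⁻¹ * ∑ χ : DirichletCharacter ℂ d, χ t := by
  unfold mainKernel uR
  rw [← mul_add, ← Finset.sum_add_distrib]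
  congr 1
  refine Finset.sum_congr rfl fun χ _ => ?_
  by_cases h : (χ.conductor : ℝ) ≤ R
  · rw [if_pos h, if_neg (not_lt.mpr h), add_zero]
  · rw [if_neg h, if_pos (not_le.mp h), zero_add]

/-- `K_R(t; d) + 𝔲_R(t; d) = 1_{t = 1}` for `d ≠ 0` (orthogonality of Dirichlet characters,
`DirichletCharacter.sum_characters_eq`).  [cite: Drappeau2017, §5 (5.1)] -/
theorem mainKernel_add_uR_eq_ite (R : ℝ) {d : ℕ} [NeZero d] (t : ZMod d) :
    mainKernel R d t + uR R d t = if t = 1 then 1 else 0 := by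
  rw [mainKernel_add_uR, DirichletCharacter.sum_characters_eq]
  have hφ : (Nat.totient d : ℂ) ≠ 0 := by
    exact_mod_cast (Nat.totient_pos.mpr (NeZero.pos d)).ne'
  split_ifs <;> simp [hφ]

end Drappeau2017

open Drappeau2017 in
/-- NAMED FACT — **Drappeau 2017, Theorem 5.1** (PLMS 114 (2017) = arXiv:1504.05549, §5, p. 17):
"Let `M, N, Q, R ≥ 1` and `η` be given, with `x := MN` and `x^{1/4} ≤ Q`. Then there exists `δ`
depending at most on `η` such that the following holds. Let two sequences `(α_m)`, `(β_n)` supported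
in `n ∈ (N, 2N]` and `m ∈ (M, 2M]` be given, which satisfy for some `A ≥ 1`, `|α_m| ≤ τ(m)^A`,
`|β_n| ≤ τ(n)^A`. Let `a₁, a₂ ∈ ℤ ∖ {0}`, and assume that `x^η ≤ N ≤ Q^{2/3−η}`, `Q ≤ x^{1/2+δ}`,
`R, |a₁|, |a₂| ≤ x^δ`. Then for small enough `η`, we have
`∑_{Q<q≤2Q, (q,a₁a₂)=1} ∑_{n,m, (n,a₂)=1} α_m β_n 𝔲_R(mn ā₁ a₂; q) ≪ x (log x)^{O(1)} R⁻¹`.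
The implicit constants depend on `η` and `A` at most."  ("There are no equidistribution
assumptions on our sequences", ibid.)  Here the smooth modulus is called `s ∼ S` and the conductor
cut-off `Rd`; quantifiers `∀ η > 0 ∃ δ > 0 ∀ A ≥ 0 ∃ C c₀ x₀ ∀ x ≥ x₀` (see the module docstring for
the rendering choices, all of which weaken the printed statement or are equivalent to it).
Deep theorem (dispersion method + Kuznetsov formula with congruence conditions, the paper's
Theorem 2.1); not proved here — users take `(h : Drappeau2017_theorem51)`.
[cite: Drappeau2017, Thm 5.1] -/
def Drappeau2017_theorem51 : Prop :=
  ∀ η : ℝ, 0 < η → ∃ δ : ℝ, 0 < δ ∧ ∀ Aτ : ℝ, 0 ≤ Aτ → ∃ C c₀ x₀ : ℝ, ∀ x : ℝ, x₀ ≤ x →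
    ∀ M N S Rd : ℝ, M * N = x → x ^ η ≤ N → N ≤ S ^ (2 / 3 - η) → x ^ (1 / 4 : ℝ) ≤ S →
      S ≤ x ^ (1 / 2 + δ) → 1 ≤ Rd → Rd ≤ x ^ δ →
    ∀ a₁ a₂ : ℤ, a₁ ≠ 0 → a₂ ≠ 0 → (|a₁| : ℝ) ≤ x ^ δ → (|a₂| : ℝ) ≤ x ^ δ →
    ∀ α β : ℕ → ℂ, (∀ m, ‖α m‖ ≤ (σ 0 m : ℝ) ^ Aτ) → (∀ n, ‖β n‖ ≤ (σ 0 n : ℝ) ^ Aτ) →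
      ‖∑ s ∈ (BFI.dyadic S).filter (fun s : ℕ => IsCoprime (s : ℤ) (a₁ * a₂)),
          ∑ m ∈ BFI.dyadic M, ∑ n ∈ (BFI.dyadic N).filter (fun n : ℕ => IsCoprime (n : ℤ) a₂),
            α m * β n *
              uR Rd s (((m * n : ℕ) : ZMod s) * ((a₁ : ZMod s))⁻¹ * ((a₂ : ZMod s)))‖ ≤
        C * x * Real.log x ^ c₀ / Rd

end Literature.NumberTheory.Sieve

end
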